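import Mathlib
import Summits.Ventures.PercRepro2.SwOutSevThmO

/-!
# An instance of Theorem A_sev with the mark inside a piece (blind cell PercRepro2, night-4 g23,
2026-08-27; proofs/NIGHT4-G23.md §3)

The graph `sevExO` on `Fin 7` (`l = 0`, `h = 1`, the mark `o = 2`, the junction `u = 3`, the PURE
dropped vertex `p₁ = 4`, the MIXED dropped vertex `p₂ = 5` whose h-piece is the mark `o` itself,
the u-arm `x = 6`) with the nine edges `hx, ux, up₁, up₂, p₂o, ho, xl, p₁l, p₂l`: the mark `o`
has NO edge leaving the region `{l}ᶜ` and lies in the component of `p₂` in `G[{l}ᶜ ∖ {h, u}]`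
(`sevExO_o_mem_compU`), so `sw_of_mixedJunctionR` (night-4 g22) does not apply; **row (SW)
holds** (`sw_sevExO`) by `sw_of_mixedJunctionR_o`.
-/

namespace Summit.Ventures.PercRepro2

namespace MixedArms

open Hull LocRows BigBlock

open scoped Classical

/-- The junction with a pure arm and a mixed arm whose piece is the mark: `l = 0`, `h = 1`,
`o = 2`, `u = 3`, `p₁ = 4`, `p₂ = 5`, `x = 6`. -/
def sevExO : Fin 9 → Sym2 (Fin 7)
  | 0 => s(1, 6) | 1 => s(3, 6) | 2 => s(3, 4) | 3 => s(3, 5) | 4 => s(5, 2) | 5 => s(1, 2)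
  | 6 => s(6, 0) | 7 => s(4, 0) | 8 => s(5, 0)

/-- The two dropped vertices. -/
def sevExOP : Fin 2 → Fin 7 := ![4, 5]

/-- An edge with no end at `c` is not an edge at `c`. -/
lemma no_edge_atO {a b c x : Fin 7} (h : s(a, b) = s(c, x)) (ha : a ≠ c) (hb : b ≠ c) : False := by
  rw [Sym2.eq_iff] at h
  rcases h with ⟨h1, _⟩ | ⟨_, h2⟩
  · exact ha h1
  · exact hb h2

/-- The other end of an edge at `a`. -/
lemma eq_of_edgeO {a b x : Fin 7} (h : s(a, b) = s(a, x)) (hab : b ≠ a) : x = b := by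
  rw [Sym2.eq_iff] at h
  rcases h with ⟨_, h2⟩ | ⟨h1, h2⟩
  · exact h2.symm
  · exact absurd h2 hab

/-- The component of `p₁ = 4` in `G[{0}ᶜ ∖ {1, 3}]` is `{4}`. -/
lemma sevExO_compU_p1 : compU sevExO ({0}ᶜ) 1 3 4 ⊆ {4} := by
  intro v hv
  unfold compU at hv
  rw [mem_cluster] at hv
  refine mem_of_conn_of_closed (S := {4}) ?_ (by simp) hv
  intro a ha b hab
  obtain ⟨_, e, he, hends⟩ := openGraph_adj.1 hab
  simp only [decide_eq_true_eq] at he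
  obtain ⟨x, hx, y, hy, hxy⟩ := he
  simp only [Set.mem_sdiff, Set.mem_compl_iff, Set.mem_singleton_iff, Set.mem_insert_iff,
    not_or] at hx hy
  simp only [Set.mem_singleton_iff] at ha ⊢
  fin_cases e <;> simp only [sevExO] at hxy hends <;> rw [Sym2.eq_iff] at hxy hends <;>
    rcases hxy with ⟨rfl, rfl⟩ | ⟨rfl, rfl⟩ <;> rcases hends with ⟨rfl, rfl⟩ | ⟨rfl, rfl⟩ <;>
    simp_all

/-- The component of `p₂ = 5` in `G[{0}ᶜ ∖ {1, 3}]` is contained in `{5, 2}`. -/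
lemma sevExO_compU_p2 : compU sevExO ({0}ᶜ) 1 3 5 ⊆ {5, 2} := by
  intro v hv
  unfold compU at hv
  rw [mem_cluster] at hv
  refine mem_of_conn_of_closed (S := {5, 2}) ?_ (by simp) hv
  intro a ha b hab
  obtain ⟨_, e, he, hends⟩ := openGraph_adj.1 hab
  simp only [decide_eq_true_eq] at he
  obtain ⟨x, hx, y, hy, hxy⟩ := he
  simp only [Set.mem_sdiff, Set.mem_compl_iff, Set.mem_singleton_iff, Set.mem_insert_iff,
    not_or] at hx hy
  simp only [Set.mem_insert_iff, Set.mem_singleton_iff] at ha ⊢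
  fin_cases e <;> simp only [sevExO] at hxy hends <;> rw [Sym2.eq_iff] at hxy hends <;>
    rcases hxy with ⟨rfl, rfl⟩ | ⟨rfl, rfl⟩ <;> rcases hends with ⟨rfl, rfl⟩ | ⟨rfl, rfl⟩ <;>
    simp_all

/-- **The mark lies in the component of `p₂`**: the hypothesis `o ∉ compU (p r)` of
`sw_of_mixedJunctionR` fails on `sevExO`. -/
lemma sevExO_o_mem_compU : (2 : Fin 7) ∈ compU sevExO ({0}ᶜ) 1 3 5 := by
  unfold compU
  refine mem_cluster_of_edge (e := 4) (mem_cluster_self _ _ _) ?_ rfl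
  simp only [decide_eq_true_eq]
  refine ⟨5, ?_, 2, ?_, rfl⟩ <;> simp

/-- The several-arms junction of `sevExO`. -/
theorem sevExO_junction : MixedJunctionR sevExO ({0}ᶜ) 1 3 sevExOP 2 where
  hne_hu := by decide
  hne_hp := by decide
  hne_up := by decide
  p_inj := by decide
  hou := by decide
  hop := by decide
  hloop_h := by intro e; fin_cases e <;> decide
  hloop_u := by intro e; fin_cases e <;> decide
  hloop_p := by intro r e; fin_cases r <;> fin_cases e <;> decide
  hnadj := by intro e; fin_cases e <;> decide
  hnadj_p := by intro r e; fin_cases r <;> fin_cases e <;> decide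
  hup := by
    intro r
    fin_cases r
    · exact ⟨2, rfl⟩
    · exact ⟨3, rfl⟩
  hu_adj_h := by
    intro e x he hx
    fin_cases e <;> simp only [sevExO] at he
    · exact (no_edge_atO he (by decide) (by decide)).elim
    · obtain rfl := eq_of_edgeO he (by decide)
      exact ⟨0, by decide⟩
    · obtain rfl := eq_of_edgeO he (by decide)
      exact absurd rfl (hx 0)
    · obtain rfl := eq_of_edgeO he (by decide)
      exact absurd rfl (hx 1)
    all_goals exact (no_edge_atO he (by decide) (by decide)).elim
  hp_adj_h := by
    intro r e x he hxU hxu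
    fin_cases r <;> simp only [sevExOP] at he
    · fin_cases e <;> simp only [sevExO] at he
      · exact (no_edge_atO he (by decide) (by decide)).elim
      · exact (no_edge_atO he (by decide) (by decide)).elim
      · rw [Sym2.eq_swap] at he
        obtain rfl := eq_of_edgeO he (by decide)
        exact absurd rfl hxu
      all_goals first
        | exact (no_edge_atO he (by decide) (by decide)).elim
        | (obtain rfl := eq_of_edgeO he (by decide); exact absurd hxU (by simp))
    · fin_cases e <;> simp only [sevExO] at he
      · exact (no_edge_atO he (by decide) (by decide)).elim
      · exact (no_edge_atO he (by decide) (by decide)).elim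
      · exact (no_edge_atO he (by decide) (by decide)).elim
      · rw [Sym2.eq_swap] at he
        obtain rfl := eq_of_edgeO he (by decide)
        exact absurd rfl hxu
      · obtain rfl := eq_of_edgeO he (by decide)
        exact ⟨5, by decide⟩
      all_goals first
        | exact (no_edge_atO he (by decide) (by decide)).elim
        | (obtain rfl := eq_of_edgeO he (by decide); exact absurd hxU (by simp))
  hcomp := by
    intro r x hx hxp e he
    fin_cases r <;> simp only [sevExOP] at hx hxp
    · have := sevExO_compU_p1 hx
      simp only [Set.mem_singleton_iff] at this
      exact hxp this
    · have := sevExO_compU_p2 hx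
      simp only [Set.mem_insert_iff, Set.mem_singleton_iff] at this
      rcases this with rfl | rfl
      · exact hxp rfl
      · revert he; fin_cases e <;> decide
  hout := by
    intro x hx hx1 hx2 hx3
    simp only [Set.mem_compl_iff, Set.mem_singleton_iff] at hx
    fin_cases x
    · exact absurd rfl hx
    · exact absurd rfl hx1
    · exact absurd rfl hx2
    · exact absurd rfl hx3
    · exact Or.inl ⟨7, 0, rfl, by simp⟩
    · exact Or.inl ⟨8, 0, rfl, by simp⟩
    · exact Or.inl ⟨6, 0, rfl, by simp⟩

/-- **Row (SW) on a junction whose mixed arm's piece is the mark `o`** (no edge leaving the region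
at `o`). -/
theorem sw_sevExO : Sw sevExO 0 1 2 :=
  sw_of_mixedJunctionR_o (by decide) sevExO_junction

end MixedArms

end Summit.Ventures.PercRepro2
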